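import Mathlib.Analysis.SpecialFunctions.Complex.Log
import Mathlib.Topology.OpenPartialHomeomorph.Basic
import HarnessLib

/-!
# The ends of a punctured compact space through disc charts: `z ↦ φ⁻¹(e^{2πiz})` maps the half-planes `{Im z > A}` onto OPEN punctured
# chart discs, and the complement of these ends is COMPACT (the topology of «`S = S̄ ∖ {s₁, …, s_m}`, `S̄` a compact Riemann surface»
# behind the one-dimensional Cattani–Deligne–Kaplan Theorem 1.1)

Topic `Literature/Topology` (namespace `Literature.Topology`), lane `lit-hodgefound` (seat `p08`, row g55-#2).  THEOREMS ONLY (no definition,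
no named fact, no instance; D-0026 net debt `0`).  Sequel of `Topology/LocallyFullOrIsolatedSubset.lean` §4 (everything-or-finite from a
compact core and open ends), supplying its «compact core `C` with `C ∪ ⋃ᵢ Eᵢ = S`» and «`Eᵢ` open» in the concrete model of a punctured
compact space, exactly in the shape consumed by `HodgeTheory/VHSDataHodgeLocusOverCurve.lean` (hypotheses `hopen`, `hcore` of
`VHSData.hodgeLocusOfNormLe_eq_univ_or_finite`).

THE PRINTED STATEMENTS THIS ABSTRACTS.  E. Cattani, P. Deligne, A. Kaplan, *On the locus of Hodge classes*, J. AMS 8 (1995) [held text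
`paper:arxiv-alg-geom_9402009`], 2.3 (p. 487): «Let `D ⊂ ℂ` be the open unit disk and `D* = D − {0}`. … The Poincaré upper half-plane `ℍ` is
the universal covering of `D*`, with covering map `z ↦ s = e^{2πiz}`»; «Proof of 1.5 ⟹ 1.1» (p. 485): «Let `S̄` be a smooth compactification of
`S` … in a neighborhood of any point in `S̄ − S`, one is in the situation considered in 1.5» — in dimension one: `S̄` compact, `S̄ − S` a
finite set of points `pᵢ`, each the centre of a chart disc `φᵢ : Uᵢ ⥲ D`, and the end of `S` at `pᵢ` is the punctured disc, uniformised by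
`σᵢ(z) = φᵢ⁻¹(e^{2πiz})` on `{Im z > A}` (radius `e^{−2πA}`).

THE MODEL.  `X` a topological space (the compactification `S̄`), `j : S → X` an embedding (the inclusion of the curve), points
`p : ι → X` off the image of `j` covering its complement, charts `φ i : OpenPartialHomeomorph X ℂ` with `p i ∈ (φ i).source`, `φ i (p i) = 0`,
whose target contains the disc of radius `e^{−2π A₀ i}` and whose punctured disc `φᵢ⁻¹(D*(e^{−2πA₀ i}))` lies in the image of `j`, and maps
`σ i : ℂ → S` with `j (σ i z) = (φ i)⁻¹ (e^{2πiz})` for `Im z > A₀ i`.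
* §1 `norm_exp_two_pi_I_mul`, `exp_two_pi_I_mul_mem_ball_iff`, `exists_exp_two_pi_I_mul_eq` — `|e^{2πiz}| = e^{−2π Im z}`, so `z ↦ e^{2πiz}`
  maps `{Im z > A}` ONTO the punctured disc `D*(e^{−2πA})` (CDK 2.3).
* §2 **`image_end_eq_preimage`** — `σᵢ{Im z > A} = j⁻¹(φᵢ⁻¹(D*(e^{−2πA})))` for `A ≥ A₀ i`; **`isOpen_image_end`** — it is OPEN in `S`
  (`hopen`).
* §3 **`exists_isCompact_core`** — for `X` compact and every choice of heights `Aᵢ ≥ A₀ᵢ` there is a COMPACT `C ⊆ S` with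
  `C ∪ ⋃ᵢ σᵢ{Im z > Aᵢ} = S` (`hcore`): `C = j⁻¹(X ∖ ⋃ᵢ φᵢ⁻¹(D(e^{−2πAᵢ})))`.
* §4 `exists_end_lift` — such maps `σᵢ` EXIST (`S` nonempty): lift `φᵢ⁻¹(e^{2πiz}) ∈ j(S)` through the injective `j`.

NOT HERE: that a compact Riemann surface minus finitely many points carries such charts (manifold structure), finiteness of `ι` (not needed
for `hopen` ∕ `hcore`), the variation of Hodge structure (see `HodgeTheory/VHSDataHodgeLocusOverPuncturedCompactCurve.lean`).

## References

* [CattaniDeligneKaplan1995] E. Cattani, P. Deligne, A. Kaplan, *On the locus of Hodge classes*, J. Amer. Math. Soc. 8 (1995) 483–506: 2.3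
  (p. 487) and «Proof of 1.5 ⟹ 1.1» (p. 485).
-/

noncomputable section

open _root_.Topology Set Complex

namespace Literature.Topology

/-! ## §1 `z ↦ e^{2πiz}` maps `{Im z > A}` onto the punctured disc of radius `e^{−2πA}` -/

/-- `Re(2πi z) = −2π Im z`. [cite: CattaniDeligneKaplan1995, 2.3 (p. 487)] -/
theorem re_two_pi_I_mul (z : ℂ) : (2 * Real.pi * I * z).re = -(2 * Real.pi * z.im) := by
  simp [mul_re, mul_im]

/-- **`|e^{2πiz}| = e^{−2π Im z}`** (the covering map `z ↦ s = e^{2πiz}` of CDK 2.3). [cite: CattaniDeligneKaplan1995, 2.3 (p. 487)] -/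
theorem norm_exp_two_pi_I_mul (z : ℂ) : ‖exp (2 * Real.pi * I * z)‖ = Real.exp (-(2 * Real.pi * z.im)) := by
  rw [norm_exp, re_two_pi_I_mul]

/-- `e^{2πiz} ≠ 0`. [cite: CattaniDeligneKaplan1995, 2.3 (p. 487)] -/
theorem exp_two_pi_I_mul_ne_zero (z : ℂ) : exp (2 * Real.pi * I * z) ≠ 0 := exp_ne_zero _

/-- **`e^{2πiz}` lies in the disc of radius `e^{−2πA}` iff `Im z > A`.** [cite: CattaniDeligneKaplan1995, 2.3 (p. 487)] -/
theorem exp_two_pi_I_mul_mem_ball_iff (z : ℂ) (A : ℝ) :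
    exp (2 * Real.pi * I * z) ∈ Metric.ball (0 : ℂ) (Real.exp (-(2 * Real.pi * A))) ↔ A < z.im := by
  rw [Metric.mem_ball, dist_zero_right, norm_exp_two_pi_I_mul, Real.exp_lt_exp, neg_lt_neg_iff]
  constructor
  · intro h
    nlinarith [Real.pi_pos]
  · intro h
    nlinarith [Real.pi_pos]

/-- `e^{2πiz}` lies in the PUNCTURED disc `D*(e^{−2πA}) = D(e^{−2πA}) ∖ {0}` iff `Im z > A`. [cite: CattaniDeligneKaplan1995, 2.3 (p. 487)] -/
theorem exp_two_pi_I_mul_mem_ball_diff_iff (z : ℂ) (A : ℝ) :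
    exp (2 * Real.pi * I * z) ∈ Metric.ball (0 : ℂ) (Real.exp (-(2 * Real.pi * A))) \ {0} ↔ A < z.im := by
  rw [Set.mem_sdiff, mem_singleton_iff, exp_two_pi_I_mul_mem_ball_iff]
  exact ⟨fun h => h.1, fun h => ⟨h, exp_two_pi_I_mul_ne_zero z⟩⟩

/-- **`z ↦ e^{2πiz}` is ONTO `ℂ ∖ {0}`, with `Im z` read off from `|s|`**: every `s ≠ 0` is `e^{2πiz}` for `z = log s ∕ (2πi)`, and then
`|s| = e^{−2π Im z}` («`ℍ` is the universal covering of `D*`, with covering map `z ↦ s = e^{2πiz}`»). [cite: CattaniDeligneKaplan1995, 2.3 (p. 487)] -/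
theorem exists_exp_two_pi_I_mul_eq {s : ℂ} (hs : s ≠ 0) : ∃ z : ℂ, exp (2 * Real.pi * I * z) = s := by
  refine ⟨log s / (2 * Real.pi * I), ?_⟩
  have h2 : (2 * Real.pi * I : ℂ) ≠ 0 := by
    simp [Real.pi_ne_zero, I_ne_zero]
  rw [mul_div_cancel₀ _ h2, exp_log hs]

/-- Every point of the punctured disc `D*(e^{−2πA})` is `e^{2πiz}` with `Im z > A`. [cite: CattaniDeligneKaplan1995, 2.3 (p. 487)] -/
theorem exists_exp_two_pi_I_mul_eq_of_mem_ball_diff {s : ℂ} {A : ℝ}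
    (hs : s ∈ Metric.ball (0 : ℂ) (Real.exp (-(2 * Real.pi * A))) \ {0}) : ∃ z : ℂ, A < z.im ∧ exp (2 * Real.pi * I * z) = s := by
  obtain ⟨z, rfl⟩ := exists_exp_two_pi_I_mul_eq (s := s) hs.2
  exact ⟨z, (exp_two_pi_I_mul_mem_ball_diff_iff z A).1 hs, rfl⟩

/-- The image of the half-plane `{Im z > A}` under `z ↦ e^{2πiz}` IS the punctured disc `D*(e^{−2πA})`. [cite: CattaniDeligneKaplan1995, 2.3 (p. 487)] -/
theorem image_exp_two_pi_I_mul_eq (A : ℝ) :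
    (fun z : ℂ => exp (2 * Real.pi * I * z)) '' {z : ℂ | A < z.im} = Metric.ball (0 : ℂ) (Real.exp (-(2 * Real.pi * A))) \ {0} := by
  ext s
  constructor
  · rintro ⟨z, hz, rfl⟩
    exact (exp_two_pi_I_mul_mem_ball_diff_iff z A).2 hz
  · intro hs
    obtain ⟨z, hz, rfl⟩ := exists_exp_two_pi_I_mul_eq_of_mem_ball_diff hs
    exact ⟨z, hz, rfl⟩

/-- Shrinking: for `A₀ ≤ A` the disc of radius `e^{−2πA}` lies in the disc of radius `e^{−2πA₀}`. [cite: CattaniDeligneKaplan1995, 2.3 (p. 487)] -/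
theorem ball_exp_subset_ball_exp {A₀ A : ℝ} (h : A₀ ≤ A) :
    Metric.ball (0 : ℂ) (Real.exp (-(2 * Real.pi * A))) ⊆ Metric.ball (0 : ℂ) (Real.exp (-(2 * Real.pi * A₀))) :=
  Metric.ball_subset_ball (Real.exp_le_exp.2 (by nlinarith [Real.pi_pos]))

/-! ## §2 The ends `σᵢ{Im z > A}` are the punctured chart discs pulled back to `S`, and are OPEN -/

variable {X : Type*} [TopologicalSpace X] {S : Type*} {ι : Type*}

/-- **The end is the punctured chart disc**: if `j (σ z) = φ⁻¹(e^{2πiz})` for `Im z > A₀` and `j` is injective, then for `A ≥ A₀`,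
**`σ{Im z > A} = j⁻¹(φ⁻¹(D*(e^{−2πA})))`** (no hypothesis on the chart is needed for this set-theoretic identity).
[cite: CattaniDeligneKaplan1995, 2.3 (p. 487) and «Proof of 1.5 ⟹ 1.1» (p. 485)] -/
theorem image_end_eq_preimage {j : S → X} (hj : Function.Injective j) (φ : OpenPartialHomeomorph X ℂ) {A₀ : ℝ} {σ : ℂ → S} (hσ : ∀ z : ℂ, A₀ < z.im → j (σ z) = φ.symm (exp (2 * Real.pi * I * z))) {A : ℝ} (hA : A₀ ≤ A) :
    σ '' {z : ℂ | A < z.im} = j ⁻¹' (φ.symm '' (Metric.ball (0 : ℂ) (Real.exp (-(2 * Real.pi * A))) \ {0})) := by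
  ext x
  constructor
  · rintro ⟨z, hz, rfl⟩
    rw [mem_preimage, hσ z (lt_of_le_of_lt hA hz)]
    exact ⟨_, (exp_two_pi_I_mul_mem_ball_diff_iff z A).2 hz, rfl⟩
  · rintro ⟨s, hs, hsx⟩
    obtain ⟨z, hz, rfl⟩ := exists_exp_two_pi_I_mul_eq_of_mem_ball_diff hs
    refine ⟨z, hz, hj ?_⟩
    rw [hσ z (lt_of_le_of_lt hA hz), hsx]

/-- `φ⁻¹` of an open subset of the chart target is open. [folklore] -/
private theorem isOpen_symm_image (φ : OpenPartialHomeomorph X ℂ) {U : Set ℂ} (hU : IsOpen U) (hUt : U ⊆ φ.target) :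
    IsOpen (φ.symm '' U) :=
  φ.symm.isOpen_image_of_subset_source hU hUt

/-- **The ends are OPEN in `S`** — hypothesis `hopen` of `VHSData.hodgeLocusOfNormLe_eq_univ_or_finite`: for `A ≥ A₀`, `σ{Im z > A}` is the
pull-back along the continuous `j` of the open set `φ⁻¹(D*(e^{−2πA}))`. [cite: CattaniDeligneKaplan1995, 2.3 (p. 487) and «Proof of 1.5 ⟹ 1.1» (p. 485)] -/
theorem isOpen_image_end [TopologicalSpace S] {j : S → X} (hj : IsEmbedding j) (φ : OpenPartialHomeomorph X ℂ) {A₀ : ℝ}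
    (hball : Metric.ball (0 : ℂ) (Real.exp (-(2 * Real.pi * A₀))) ⊆ φ.target) {σ : ℂ → S} (hσ : ∀ z : ℂ, A₀ < z.im → j (σ z) = φ.symm (exp (2 * Real.pi * I * z))) {A : ℝ} (hA : A₀ ≤ A) :
    IsOpen (σ '' {z : ℂ | A < z.im}) := by
  rw [image_end_eq_preimage hj.injective φ hσ hA]
  refine (isOpen_symm_image φ (Metric.isOpen_ball.sdiff isClosed_singleton) ?_).preimage hj.continuous
  exact sdiff_subset.trans ((ball_exp_subset_ball_exp hA).trans hball)

/-- The family form of `hopen`: for charts `φ i` and lifts `σ i` as above, **every end `σᵢ{Im z > A}` (`A ≥ A₀ i`) is open in `S`**.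
[cite: CattaniDeligneKaplan1995, 2.3 (p. 487) and «Proof of 1.5 ⟹ 1.1» (p. 485)] -/
theorem isOpen_image_ends [TopologicalSpace S] {j : S → X} (hj : IsEmbedding j) (φ : ι → OpenPartialHomeomorph X ℂ)
    (A₀ : ι → ℝ) (hball : ∀ i, Metric.ball (0 : ℂ) (Real.exp (-(2 * Real.pi * A₀ i))) ⊆ (φ i).target) (σ : ι → ℂ → S) (hσ : ∀ (i : ι) (z : ℂ), A₀ i < z.im → j (σ i z) = (φ i).symm (exp (2 * Real.pi * I * z))) :
    ∀ (i : ι) (A : ℝ), A₀ i ≤ A → IsOpen (σ i '' {z : ℂ | A < z.im}) :=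
  fun i _ hA => isOpen_image_end hj (φ i) (hball i) (hσ i) hA

/-! ## §3 The complement of the ends is COMPACT (`X` compact) -/

/-- The centre `p` of the chart lies in `φ⁻¹(D(r))` for every radius `r > 0` (`φ p = 0`). [folklore] -/
private theorem centre_mem_symm_image_ball (φ : OpenPartialHomeomorph X ℂ) {p : X} (hp : p ∈ φ.source) (hφp : φ p = 0) {r : ℝ}
    (hr : 0 < r) : p ∈ φ.symm '' Metric.ball (0 : ℂ) r :=
  ⟨0, Metric.mem_ball_self hr, by rw [← hφp, φ.left_inv hp]⟩

/-- **A compact core** — hypothesis `hcore` of `VHSData.hodgeLocusOfNormLe_eq_univ_or_finite`: `X` COMPACT, `j : S → X` an embedding whose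
image misses exactly (at most) the chart centres `p i` (`p i ∉ j(S)`, `X ∖ j(S) ⊆ {p i}`), charts `φ i` centred at `p i` whose targets
contain the discs `D(e^{−2πA₀ i})`, and lifts `σ i` as in §2.  Then for every choice
of heights `A i ≥ A₀ i` there is a COMPACT `C ⊆ S` with **`C ∪ ⋃ᵢ σᵢ{Im z > A i} = S`**, namely `C = j⁻¹(X ∖ ⋃ᵢ φᵢ⁻¹(D(e^{−2πAᵢ})))`
(«`S̄` a compactification of `S` … in a neighborhood of any point in `S̄ − S`, one is in the situation considered in 1.5»).
[cite: CattaniDeligneKaplan1995, «Proof of 1.5 ⟹ 1.1» (p. 485) and 2.3 (p. 487)] -/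
theorem exists_isCompact_core [CompactSpace X] [TopologicalSpace S] {j : S → X} (hj : IsEmbedding j) (p : ι → X)
    (hpS : ∀ i, p i ∉ range j) (hcov : ∀ x : X, x ∉ range j → ∃ i, x = p i) (φ : ι → OpenPartialHomeomorph X ℂ)
    (hp : ∀ i, p i ∈ (φ i).source) (hφp : ∀ i, φ i (p i) = 0) (A₀ : ι → ℝ)
    (hball : ∀ i, Metric.ball (0 : ℂ) (Real.exp (-(2 * Real.pi * A₀ i))) ⊆ (φ i).target) (σ : ι → ℂ → S) (hσ : ∀ (i : ι) (z : ℂ), A₀ i < z.im → j (σ i z) = (φ i).symm (exp (2 * Real.pi * I * z))) :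
    ∀ A : ι → ℝ, (∀ i, A₀ i ≤ A i) → ∃ C : Set S, IsCompact C ∧ C ∪ ⋃ i, σ i '' {z : ℂ | A i < z.im} = univ := by
  intro A hA
  -- the open neighbourhood `B = ⋃ᵢ φᵢ⁻¹(D(e^{−2πAᵢ}))` of the punctures and the compact `K = X ∖ B ⊆ j(S)`
  set B : Set X := ⋃ i, (φ i).symm '' Metric.ball (0 : ℂ) (Real.exp (-(2 * Real.pi * A i))) with hB
  have hBopen : IsOpen B := isOpen_iUnion fun i =>
    isOpen_symm_image (φ i) Metric.isOpen_ball ((ball_exp_subset_ball_exp (hA i)).trans (hball i))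
  have hKcpt : IsCompact Bᶜ := hBopen.isClosed_compl.isCompact
  have hKS : Bᶜ ⊆ range j := by
    intro x hx
    by_contra hxj
    obtain ⟨i, rfl⟩ := hcov x hxj
    exact hx (mem_iUnion.2 ⟨i, centre_mem_symm_image_ball (φ i) (hp i) (hφp i) (Real.exp_pos _)⟩)
  refine ⟨j ⁻¹' Bᶜ, ?_, ?_⟩
  · -- `j⁻¹(K)` is compact since `j` is an embedding and `j(j⁻¹ K) = K`
    exact hj.isInducing.isCompact_preimage' hKcpt hKS
  · refine eq_univ_of_forall fun x => ?_
    by_cases hx : j x ∈ B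
    · obtain ⟨i, s, hs, hsx⟩ := mem_iUnion.1 hx
      have hs0 : s ≠ 0 := by
        rintro rfl
        exact hpS i ⟨x, by rw [← hsx, ← hφp i, (φ i).left_inv (hp i)]⟩
      refine Or.inr (mem_iUnion.2 ⟨i, ?_⟩)
      rw [image_end_eq_preimage hj.injective (φ i) (hσ i) (hA i)]
      exact ⟨s, ⟨hs, hs0⟩, hsx⟩
    · exact Or.inl hx

/-! ## §4 The lifts `σᵢ` exist -/

/-- **Lifting the uniformisation through `j`**: with `S` nonempty, `j` injective and the punctured chart disc `φᵢ⁻¹(D*(e^{−2πA₀ i}))` inside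
`j(S)`, there ARE maps `σ i : ℂ → S` with `j (σ i z) = φᵢ⁻¹(e^{2πiz})` for `Im z > A₀ i` (`σ i = j⁻¹ ∘ φᵢ⁻¹ ∘ e^{2πi·}` there).
[cite: CattaniDeligneKaplan1995, 2.3 (p. 487)] -/
theorem exists_end_lift [Nonempty S] (j : S → X) (φ : ι → OpenPartialHomeomorph X ℂ) (A₀ : ι → ℝ)
    (hpunct : ∀ i, (φ i).symm '' (Metric.ball (0 : ℂ) (Real.exp (-(2 * Real.pi * A₀ i))) \ {0}) ⊆ range j) :
    ∃ σ : ι → ℂ → S, ∀ (i : ι) (z : ℂ), A₀ i < z.im → j (σ i z) = (φ i).symm (exp (2 * Real.pi * I * z)) := by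
  refine ⟨fun i z => Function.invFun j ((φ i).symm (exp (2 * Real.pi * I * z))), fun i z hz => ?_⟩
  exact Function.invFun_eq (hpunct i ⟨_, (exp_two_pi_I_mul_mem_ball_diff_iff z (A₀ i)).2 hz, rfl⟩)

/-- The lifts are unique on `{Im z > A₀ i}` when `j` is injective: any two agree there. [cite: CattaniDeligneKaplan1995, 2.3 (p. 487)] -/
theorem end_lift_unique {j : S → X} (hj : Function.Injective j) (φ : OpenPartialHomeomorph X ℂ) {A₀ : ℝ} {σ σ' : ℂ → S}
    (hσ : ∀ z : ℂ, A₀ < z.im → j (σ z) = φ.symm (exp (2 * Real.pi * I * z)))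
    (hσ' : ∀ z : ℂ, A₀ < z.im → j (σ' z) = φ.symm (exp (2 * Real.pi * I * z))) {z : ℂ} (hz : A₀ < z.im) : σ z = σ' z :=
  hj (by rw [hσ z hz, hσ' z hz])

/-- The lifts are `1`-periodic on `{Im z > A₀}`: `σ (z + 1) = σ z` (`e^{2πi(z+1)} = e^{2πiz}`; the deck transformation of `ℍ → D*`).
[cite: CattaniDeligneKaplan1995, 2.3 (p. 487)] -/
theorem end_lift_add_one {j : S → X} (hj : Function.Injective j) (φ : OpenPartialHomeomorph X ℂ) {A₀ : ℝ} {σ : ℂ → S}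
    (hσ : ∀ z : ℂ, A₀ < z.im → j (σ z) = φ.symm (exp (2 * Real.pi * I * z))) {z : ℂ} (hz : A₀ < z.im) : σ (z + 1) = σ z := by
  refine hj ?_
  have hz1 : A₀ < (z + 1).im := by simpa using hz
  rw [hσ z hz, hσ (z + 1) hz1, mul_add, mul_one, exp_add, exp_two_pi_mul_I, mul_one]

/-- The image point `j (σ z)` lies in the chart source and `φ (j (σ z)) = e^{2πiz}` (`Im z > A₀`, the disc of radius `e^{−2πA₀}` inside the
target). [cite: CattaniDeligneKaplan1995, 2.3 (p. 487)] -/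
theorem chart_apply_end_lift {j : S → X} (φ : OpenPartialHomeomorph X ℂ) {A₀ : ℝ}
    (hball : Metric.ball (0 : ℂ) (Real.exp (-(2 * Real.pi * A₀))) ⊆ φ.target) {σ : ℂ → S}
    (hσ : ∀ z : ℂ, A₀ < z.im → j (σ z) = φ.symm (exp (2 * Real.pi * I * z))) {z : ℂ} (hz : A₀ < z.im) :
    j (σ z) ∈ φ.source ∧ φ (j (σ z)) = exp (2 * Real.pi * I * z) := by
  have ht : exp (2 * Real.pi * I * z) ∈ φ.target := hball ((exp_two_pi_I_mul_mem_ball_iff z A₀).2 hz)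
  rw [hσ z hz]
  exact ⟨φ.map_target ht, φ.right_inv ht⟩

end Literature.Topology

end
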